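import Literature.Analysis.FunctionSpaces.TorusAxisAverageCalculus
import Literature.Analysis.FunctionSpaces.TorusFourierSynthesis
import Literature.Analysis.FunctionSpaces.TorusFourierCalculus
import Literature.Analysis.FunctionSpaces.TorusFourierModes
import Literature.Analysis.FunctionSpaces.TorusRieszFischerParam
import Literature.Analysis.Fourier.LipschitzFourierTail
import HarnessLib

/-!
# Transversal shear maps of the flat torus and their Koopman operators on the Fourier side

Analysis/FunctionSpaces support file (all proved; no named facts). A *transversal shear* of
`T^d = (ℝ/ℤ)^d` is the map `Φ(x) = x - φ(x_j) eᵢ` (`i ≠ j`) for a smooth `1`-periodic real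
profile `φ` (`Torus.ShearProfile`, `Torus.shearMap`); it is the time-one map of the divergence-free
shear flow `ẋ = -φ(x_j) eᵢ`, and its Koopman operator `θ ↦ θ ∘ Φ` is how an inviscid passive
scalar is transported by such a flow ("the solution of `∂ₜw + v(x₂)∂₁w = 0` is
`w₀(x₁ - t v(x₂), x₂)`", Bardos–Titi–Wiedemann 2012, Lemma 4; the same skew translation is
`measurePreserving_skewTranslate` of `Literature/Barriers/AnomalousDissipation/
ShearFlowViscositySelectionModalTransport`). This file records the elementary harmonic analysis
of these operators, used by the shear-cascade construction of
`Literature/Analysis/FluidPDE/ShearCascade*` (an alternating-shear route to Cheskidov's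
time-periodic dissipation anomaly, `Literature.Analysis.FluidPDE.cheskidov_time_periodic_anomaly`):

* `Torus.shearMap`, `Torus.shearEquiv`, `Torus.IsSmooth.comp_shearMap`,
  `Torus.measurePreserving_shearMap` (`d = 2`: a skew product of circle translations in the
  product coordinates `MeasurableEquiv.piFinTwo`), `Torus.integral_comp_shearMap`;
* the phase function `Torus.twist P n = e_{-n} ∘ φ` picked up by the `i`-th mode `n`
  (`Torus.mFourier_shearMap`: `e_k ∘ Φ = g_{k_i}(x_j) e_k`), the Fourier coefficients of a
  function of one coordinate (`Torus.mFourierCoeff_comp_eval`), and the **fibre formula**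
  `Torus.mFourierCoeff_comp_shearMap`: `𝓕(θ ∘ Φ)(k) = ∑_m ĝ_{k_i}(m) 𝓕θ(k - m eⱼ)` — the shear
  acts fibrewise on `{k : k_i = n}` as the convolution with the circle coefficients of `g_n`;
* its consequences: supports in the direction `eᵢ` are preserved
  (`mFourierCoeff_comp_shearMap_eq_zero_of_apply_not_mem`); for a `1/F`-periodic profile the
  coefficients `ĝ_n(m)` vanish unless `F ∣ m` (`fourierCoeff_twist_eq_zero`), so supports in
  `F`-invariant sets of `eⱼ`-frequencies are preserved
  (`mFourierCoeff_comp_shearMap_eq_zero_of_invariant`) and on functions band limited to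
  `|k_j| < F/2` the shear is the Fourier multiplier `ĝ_{k_i}(0) = ∫₀¹ exp(-2πi k_i φ)`
  (`mFourierCoeff_comp_shearMap_of_band`, `fourierCoeff_twist_zero`);
* spectral pieces `Torus.modePiece A θ` of smooth functions (smooth, coefficients `1_A 𝓕θ`,
  finite disjoint decompositions `eq_sum_modePiece`), monochromatic functions
  (`comp_shearMap_of_fibre`: `θ ∘ Φ = g_n(x_j) θ` when all modes have `k_i = n`), Parseval across
  fibres (`integral_norm_sq_sum_eq_of_fibre`) and the **near-identity estimate**
  `integral_norm_sq_comp_shearMap_sub_le`: `∫‖θ ∘ Φ - θ‖² ≤ (2πκ sup|φ|)² ∫‖θ‖²` when the modes of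
  `θ` have `|k_i| ≤ κ`.

## Mathlib / tree search

Mathlib: `UnitAddTorus.mFourier*`, `mFourierCoeff`, `hasSum_mFourier_series_apply_of_summable`,
`fourierCoeff`, `MeasurePreserving.skew_product`, `volume_preserving_piFinTwo`,
`measurePreserving_eval`, `integral_tsum`; no shear maps / Koopman operators on tori (searched
`shear`, `Koopman`, `skew` with `mFourierCoeff`: only the tree's barrier file above, for `T³` and
a.e. statements). Tree: `Torus.mFourier_add_single`, `Torus.mFourierCoeff_eq_zero_of_forall_add_single`
(`TorusAxisAverage`), `Torus.fourierSynth`/`RapidDecay` (`TorusFourierSynthesis`), Parseval for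
continuous functions `Torus.hasSum_sq_mFourierCoeff_of_continuous` (`TorusFourierCalculus`),
`fourierCoeff_comp_add_right` (`Fourier/LipschitzFourierTail`).

## References

* C. Bardos, E. S. Titi, E. Wiedemann, C. R. Math. Acad. Sci. Paris 350 (2012) 757–760, Lemma 4
  (transport by a shear flow).
* L. Grafakos, *Classical Fourier Analysis*, 3rd ed. (2014), §3.1.1, Prop. 3.2.5, Thm. 3.3.9
  (Fourier series on `T^d`).
-/

open MeasureTheory Set Filter Topology UnitAddTorus Function
open scoped ENNReal NNReal ContDiff

noncomputable section

namespace Literature.Analysis.FunctionSpaces.Torus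

variable {d : Type*} [Fintype d] [DecidableEq d]

/-! ## Smooth periodic profiles and the transversal shear map -/

/-- A smooth `1`-periodic real profile `φ : ℝ → ℝ` (the displacement of a shear as a function of
the transversal coordinate). [folklore] -/
structure ShearProfile where
  /-- the profile -/
  toFun : ℝ → ℝ
  /-- `1`-periodicity -/
  periodic' : Function.Periodic toFun 1
  /-- smoothness -/
  contDiff' : ContDiff ℝ ∞ toFun

namespace ShearProfile

/-- A profile is used as the function it wraps. [folklore] -/
instance : CoeFun ShearProfile (fun _ => ℝ → ℝ) := ⟨ShearProfile.toFun⟩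

/-- The profile is `1`-periodic. [folklore] -/
theorem periodic (P : ShearProfile) : Function.Periodic P 1 := P.periodic'

/-- The profile is smooth. [folklore] -/
theorem contDiff (P : ShearProfile) : ContDiff ℝ ∞ P := P.contDiff'

/-- The profile is continuous. [folklore] -/
theorem continuous (P : ShearProfile) : Continuous P := P.contDiff.continuous

/-- The profile as a function on the circle `T = ℝ/ℤ`. [folklore] -/
def onCircle (P : ShearProfile) : UnitAddCircle → ℝ := P.periodic.lift

/-- The circle profile at the class of `t` is `φ(t)`. [folklore] -/
@[simp]
theorem onCircle_coe (P : ShearProfile) (t : ℝ) : P.onCircle (t : UnitAddCircle) = P t :=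
  P.periodic.lift_coe t

/-- The circle profile is continuous (quotient map). [folklore] -/
theorem continuous_onCircle (P : ShearProfile) : Continuous P.onCircle := by
  have h : P.onCircle ∘ (QuotientAddGroup.mk : ℝ → UnitAddCircle) = P := by
    funext x; exact P.periodic.lift_coe x
  rw [onCircle, (QuotientAddGroup.isQuotientMap_mk _).continuous_iff]
  change Continuous (P.onCircle ∘ (QuotientAddGroup.mk : ℝ → UnitAddCircle))
  rw [h]
  exact P.continuous

/-- The circle profile is measurable. [folklore] -/
theorem measurable_onCircle (P : ShearProfile) : Measurable P.onCircle :=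
  P.continuous_onCircle.measurable

/-- The opposite profile `-φ` (it drives the inverse shear). [folklore] -/
def neg (P : ShearProfile) : ShearProfile where
  toFun := fun t => -P t
  periodic' := fun t => by simp [P.periodic t]
  contDiff' := P.contDiff.neg

/-- Values of the opposite profile. [folklore] -/
@[simp]
theorem neg_apply (P : ShearProfile) (t : ℝ) : P.neg t = -P t := rfl

/-- The circle profile of the opposite profile. [folklore] -/
@[simp]
theorem onCircle_neg (P : ShearProfile) (b : UnitAddCircle) : P.neg.onCircle b = -P.onCircle b := by
  induction b using QuotientAddGroup.induction_on
  rw [onCircle_coe, onCircle_coe, neg_apply]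

/-- **The scaled profile** `t ↦ D S(F t)` of a base profile `S`: displacement amplitude `D`,
`F` oscillations per period (`F ∈ ℕ` keeps it `1`-periodic). [folklore] -/
def scale (S : ShearProfile) (D : ℝ) (F : ℕ) : ShearProfile where
  toFun := fun t => D * S (F * t)
  periodic' := fun t => by
    have h := S.periodic.nat_mul F (F * t)
    simp only [mul_one] at h ⊢
    rw [mul_add, mul_one, h]
  contDiff' := contDiff_const.mul (S.contDiff.comp (contDiff_const.mul contDiff_id))

/-- Values of the scaled profile. [folklore] -/
@[simp]
theorem scale_apply (S : ShearProfile) (D : ℝ) (F : ℕ) (t : ℝ) : S.scale D F t = D * S (F * t) := rfl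

/-- The scaled profile is `1/F`-periodic. [folklore] -/
theorem scale_add_inv (S : ShearProfile) (D : ℝ) {F : ℕ} (hF : 0 < F) (t : ℝ) :
    S.scale D F (t + (F : ℝ)⁻¹) = S.scale D F t := by
  have hF' : (F : ℝ) ≠ 0 := by exact_mod_cast hF.ne'
  rw [scale_apply, scale_apply, mul_add, mul_inv_cancel₀ hF', S.periodic]

/-- `|D S(F t)| ≤ |D| sup|S|`. [folklore] -/
theorem abs_scale_le (S : ShearProfile) (D : ℝ) (F : ℕ) {M : ℝ} (hM : ∀ t, |S t| ≤ M) (t : ℝ) :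
    |S.scale D F t| ≤ |D| * M := by
  rw [scale_apply, abs_mul]
  exact mul_le_mul_of_nonneg_left (hM _) (abs_nonneg _)

end ShearProfile

/-- **Averaging over the fast variable**: for a continuous `1`-periodic `g` and `F ≥ 1`,
`∫₀¹ g(F t) dt = ∫₀¹ g`. [folklore] -/
theorem intervalIntegral_comp_natCast_mul {E : Type*} [NormedAddCommGroup E] [NormedSpace ℝ E]
    {g : ℝ → E} (hg : Continuous g) (hper : Function.Periodic g 1) {F : ℕ} (hF : 0 < F) :
    ∫ t in (0 : ℝ)..1, g (F * t) = ∫ t in (0 : ℝ)..1, g t := by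
  have hF' : (F : ℝ) ≠ 0 := by exact_mod_cast hF.ne'
  rw [intervalIntegral.integral_comp_mul_left g hF', mul_zero, mul_one]
  have h := hper.intervalIntegral_add_zsmul_eq (F : ℤ) 0 (fun t₁ t₂ => hg.intervalIntegrable t₁ t₂)
  simp only [zero_add, zsmul_eq_mul, mul_one, Int.cast_natCast] at h
  rw [h, ← Int.cast_smul_eq_zsmul ℝ, Int.cast_natCast, smul_smul, inv_mul_cancel₀ hF', one_smul]

/-- **The transversal shear map** of `T^d` along the axis `i`, driven by the coordinate `j`:
`x ↦ x - φ(x_j) eᵢ`. [folklore] -/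
def shearMap (i j : d) (P : ShearProfile) (x : UnitAddTorus d) : UnitAddTorus d :=
  x - Pi.single i ((P.onCircle (x j) : ℝ) : UnitAddCircle)

/-- The planar lift of the shear map: `y ↦ y - φ(y_j) eᵢ` on `ℝ^d`. [folklore] -/
def shearMapLift (i j : d) (P : ShearProfile) (y : EuclideanSpace ℝ d) : EuclideanSpace ℝ d :=
  y - (P (y j)) • EuclideanSpace.single i (1 : ℝ)

omit [Fintype d] in
/-- Unfolding the shear map. [folklore] -/
theorem shearMap_apply (i j : d) (P : ShearProfile) (x : UnitAddTorus d) :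
    shearMap i j P x = x - Pi.single i ((P.onCircle (x j) : ℝ) : UnitAddCircle) := rfl

omit [Fintype d] in
/-- The displaced coordinate of the shear map. [folklore] -/
theorem shearMap_apply_same (i j : d) (P : ShearProfile) (x : UnitAddTorus d) :
    shearMap i j P x i = x i - ((P.onCircle (x j) : ℝ) : UnitAddCircle) := by
  simp [shearMap_apply]

omit [Fintype d] in
/-- The shear map leaves the coordinates `l ≠ i` unchanged. [folklore] -/
theorem shearMap_apply_of_ne {i j : d} (P : ShearProfile) (x : UnitAddTorus d) {l : d} (hl : l ≠ i) :
    shearMap i j P x l = x l := by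
  simp [shearMap_apply, Pi.single_eq_of_ne hl]

omit [Fintype d] in
/-- The shear map intertwines with the covering projection. [folklore] -/
theorem shearMap_proj (i j : d) (P : ShearProfile) (y : EuclideanSpace ℝ d) :
    shearMap i j P (proj y) = proj (shearMapLift i j P y) := by
  funext l
  by_cases hl : l = i
  · subst hl
    rw [shearMap_apply_same, proj_apply, proj_apply, ShearProfile.onCircle_coe, shearMapLift,
      ← AddCircle.coe_sub]
    congr 1
    simp
  · rw [shearMap_apply_of_ne P _ hl, proj_apply, proj_apply, shearMapLift]
    simp [hl]

/-- The planar lift of the shear map is smooth. [folklore] -/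
theorem contDiff_shearMapLift (i j : d) (P : ShearProfile) : ContDiff ℝ ∞ (shearMapLift i j P) := by
  unfold shearMapLift
  refine contDiff_id.sub ((P.contDiff.comp ?_).smul contDiff_const)
  exact (EuclideanSpace.proj j : EuclideanSpace ℝ d →L[ℝ] ℝ).contDiff

omit [Fintype d] in
/-- `lift (θ ∘ shear) = lift θ ∘ shearLift`. [folklore] -/
theorem lift_comp_shearMap {F : Type*} (i j : d) (P : ShearProfile) (θ : UnitAddTorus d → F) :
    lift (θ ∘ shearMap i j P) = lift θ ∘ shearMapLift i j P := by
  funext y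
  simp only [lift_apply, Function.comp_apply, shearMap_proj]

/-- **Composition with a transversal shear preserves smoothness.** [folklore] -/
theorem IsSmooth.comp_shearMap {F : Type*} [NormedAddCommGroup F] [NormedSpace ℝ F]
    {θ : UnitAddTorus d → F} (hθ : IsSmooth θ) (i j : d) (P : ShearProfile) :
    IsSmooth (θ ∘ shearMap i j P) := by
  change ContDiff ℝ ∞ (lift (θ ∘ shearMap i j P))
  rw [lift_comp_shearMap]
  exact hθ.comp (contDiff_shearMapLift i j P)

omit [Fintype d] in
/-- The shear map is continuous. [folklore] -/
theorem continuous_shearMap (i j : d) (P : ShearProfile) : Continuous (shearMap i j P) := by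
  unfold shearMap
  refine continuous_id.sub (continuous_pi fun l => ?_)
  by_cases hl : l = i
  · subst hl
    simp only [Pi.single_eq_same]
    exact (AddCircle.continuous_mk' (1 : ℝ)).comp (P.continuous_onCircle.comp (continuous_apply j))
  · simp only [Pi.single_eq_of_ne hl]
    exact continuous_const

/-- The shear map is measurable. [folklore] -/
theorem measurable_shearMap (i j : d) (P : ShearProfile) : Measurable (shearMap i j P) :=
  (continuous_shearMap i j P).measurable

omit [Fintype d] in
/-- The shear driven by `-φ` inverts the shear driven by `φ` (the driving coordinate `x_j`,
`j ≠ i`, is unchanged). [folklore] -/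
theorem shearMap_neg_shearMap {i j : d} (hij : i ≠ j) (P : ShearProfile) (x : UnitAddTorus d) :
    shearMap i j P.neg (shearMap i j P x) = x := by
  have hj : shearMap i j P x j = x j := shearMap_apply_of_ne P x hij.symm
  rw [shearMap_apply, hj, ShearProfile.onCircle_neg, shearMap_apply, sub_sub, ← Pi.single_add]
  simp

omit [Fintype d] in
/-- The shear driven by `φ` inverts the shear driven by `-φ`. [folklore] -/
theorem shearMap_shearMap_neg {i j : d} (hij : i ≠ j) (P : ShearProfile) (x : UnitAddTorus d) :
    shearMap i j P (shearMap i j P.neg x) = x := by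
  have hj : shearMap i j P.neg x j = x j := shearMap_apply_of_ne P.neg x hij.symm
  rw [shearMap_apply, hj, shearMap_apply, ShearProfile.onCircle_neg, sub_sub, ← Pi.single_add]
  simp

/-- The transversal shear as a measurable equivalence of `T^d`. [folklore] -/
def shearEquiv {i j : d} (hij : i ≠ j) (P : ShearProfile) : UnitAddTorus d ≃ᵐ UnitAddTorus d where
  toFun := shearMap i j P
  invFun := shearMap i j P.neg
  left_inv := shearMap_neg_shearMap hij P
  right_inv := shearMap_shearMap_neg hij P
  measurable_toFun := measurable_shearMap i j P
  measurable_invFun := measurable_shearMap i j P.neg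

/-- The measurable equivalence is the shear map. [folklore] -/
theorem coe_shearEquiv {i j : d} (hij : i ≠ j) (P : ShearProfile) : ⇑(shearEquiv hij P) = shearMap i j P := rfl


/-! ## The shear map preserves the volume of `T²` -/

section PlanarVolume

local notation "𝕋²" => UnitAddTorus (Fin 2)

omit [Fintype d] [DecidableEq d] in
/-- Product coordinates on `T²` (Mathlib's `MeasurableEquiv.piFinTwo`). [folklore] -/
theorem piFinTwo_symm_apply_eq (p : UnitAddCircle × UnitAddCircle) :
    (MeasurableEquiv.piFinTwo fun _ : Fin 2 => UnitAddCircle).symm p = (![p.1, p.2] : 𝕋²) := by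
  ext l; fin_cases l <;> rfl

omit [Fintype d] [DecidableEq d] in
/-- Product coordinates on `T²` preserve volume (Mathlib's `volume_preserving_piFinTwo`). [folklore] -/
theorem measurePreserving_vecTwo :
    MeasurePreserving (fun p : UnitAddCircle × UnitAddCircle => (![p.1, p.2] : 𝕋²))
      ((volume : Measure UnitAddCircle).prod volume) volume := by
  have h := (volume_preserving_piFinTwo fun _ : Fin 2 => UnitAddCircle).symm
  have hfun : (fun p : UnitAddCircle × UnitAddCircle => (![p.1, p.2] : 𝕋²)) =
      (MeasurableEquiv.piFinTwo fun _ : Fin 2 => UnitAddCircle).symm :=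
    funext fun p => (piFinTwo_symm_apply_eq p).symm
  rw [hfun]
  exact h

omit [Fintype d] [DecidableEq d] in
/-- Product coordinates on `T²` form a measurable embedding. [folklore] -/
theorem measurableEmbedding_vecTwo :
    MeasurableEmbedding (fun p : UnitAddCircle × UnitAddCircle => (![p.1, p.2] : 𝕋²)) := by
  have hfun : (fun p : UnitAddCircle × UnitAddCircle => (![p.1, p.2] : 𝕋²)) =
      (MeasurableEquiv.piFinTwo fun _ : Fin 2 => UnitAddCircle).symm :=
    funext fun p => (piFinTwo_symm_apply_eq p).symm
  rw [hfun]
  exact (MeasurableEquiv.piFinTwo fun _ : Fin 2 => UnitAddCircle).symm.measurableEmbedding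

omit [Fintype d] [DecidableEq d] in
/-- The skew translation `(a, b) ↦ (a, b - c(a))` of `T × T` preserves the product volume. [folklore] -/
theorem measurePreserving_skew_snd {c : UnitAddCircle → UnitAddCircle} (hc : Measurable c) :
    MeasurePreserving (fun p : UnitAddCircle × UnitAddCircle => (p.1, p.2 - c p.1))
      ((volume : Measure UnitAddCircle).prod volume) ((volume : Measure UnitAddCircle).prod volume) := by
  refine (MeasurePreserving.id volume).skew_product (g := fun a b => b - c a)
    (measurable_snd.sub (hc.comp measurable_fst)) (Eventually.of_forall fun a => ?_)
  exact (measurePreserving_sub_right volume (c a)).map_eq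

omit [Fintype d] [DecidableEq d] in
/-- The skew translation `(a, b) ↦ (a - c(b), b)` of `T × T` preserves the product volume. [folklore] -/
theorem measurePreserving_skew_fst {c : UnitAddCircle → UnitAddCircle} (hc : Measurable c) :
    MeasurePreserving (fun p : UnitAddCircle × UnitAddCircle => (p.1 - c p.2, p.2))
      ((volume : Measure UnitAddCircle).prod volume) ((volume : Measure UnitAddCircle).prod volume) := by
  have hswap : MeasurePreserving (Prod.swap : UnitAddCircle × UnitAddCircle → UnitAddCircle × UnitAddCircle)
      ((volume : Measure UnitAddCircle).prod volume) ((volume : Measure UnitAddCircle).prod volume) :=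
    Measure.measurePreserving_swap
  exact hswap.comp ((measurePreserving_skew_snd hc).comp hswap)

/-- **The transversal shear preserves the volume of `T²`** (in product coordinates it is a skew
product of translations of `T`). [folklore] -/
theorem measurePreserving_shearMap {i j : Fin 2} (hij : i ≠ j) (P : ShearProfile) :
    MeasurePreserving (shearMap i j P) volume volume := by
  set c : UnitAddCircle → UnitAddCircle := fun b => ((P.onCircle b : ℝ) : UnitAddCircle) with hc_def
  have hc : Measurable c := (AddCircle.continuous_mk' (1 : ℝ)).measurable.comp P.measurable_onCircle
  -- the product-coordinate form `Ψ` of the shear and the intertwining `Φ ∘ vec = vec ∘ Ψ`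
  obtain ⟨Ψ, hΨ, hinter⟩ : ∃ Ψ : UnitAddCircle × UnitAddCircle → UnitAddCircle × UnitAddCircle,
      MeasurePreserving Ψ ((volume : Measure UnitAddCircle).prod volume) ((volume : Measure UnitAddCircle).prod volume) ∧
      shearMap i j P ∘ (fun p : UnitAddCircle × UnitAddCircle => (![p.1, p.2] : 𝕋²)) =
        (fun p : UnitAddCircle × UnitAddCircle => (![p.1, p.2] : 𝕋²)) ∘ Ψ := by
    fin_cases i <;> fin_cases j
    · exact absurd rfl hij
    · refine ⟨fun p => (p.1 - c p.2, p.2), measurePreserving_skew_fst hc, ?_⟩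
      funext p
      ext l
      fin_cases l
      · simp [shearMap_apply, hc_def]
      · simp [shearMap_apply]
    · refine ⟨fun p => (p.1, p.2 - c p.1), measurePreserving_skew_snd hc, ?_⟩
      funext p
      ext l
      fin_cases l
      · simp [shearMap_apply]
      · simp [shearMap_apply, hc_def]
    · exact absurd rfl hij
  have hΦm : Measurable (shearMap i j P) := measurable_shearMap i j P
  refine ⟨hΦm, ?_⟩
  calc Measure.map (shearMap i j P) volume
      = Measure.map (shearMap i j P) (Measure.map (fun p : UnitAddCircle × UnitAddCircle => (![p.1, p.2] : 𝕋²))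
          ((volume : Measure UnitAddCircle).prod volume)) := by rw [measurePreserving_vecTwo.map_eq]
    _ = Measure.map (shearMap i j P ∘ fun p : UnitAddCircle × UnitAddCircle => (![p.1, p.2] : 𝕋²))
          ((volume : Measure UnitAddCircle).prod volume) :=
        Measure.map_map hΦm measurePreserving_vecTwo.measurable
    _ = volume := by rw [hinter]; exact (measurePreserving_vecTwo.comp hΨ).map_eq

/-- **Change of variables**: `∫ f ∘ shear = ∫ f` on `T²`. [folklore] -/
theorem integral_comp_shearMap {E : Type*} [NormedAddCommGroup E] [NormedSpace ℝ E]
    {i j : Fin 2} (hij : i ≠ j) (P : ShearProfile) (f : 𝕋² → E) :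
    ∫ x, f (shearMap i j P x) = ∫ x, f x := by
  have h : MeasurePreserving (shearEquiv hij P) volume volume := measurePreserving_shearMap hij P
  exact h.integral_comp' f

end PlanarVolume


/-! ## Characters and the shear: the phase function `g_n = e_{-n} ∘ φ` -/

section Fourier

variable {V : Type*} [NormedAddCommGroup V] [NormedSpace ℂ V]

omit [DecidableEq d] in
/-- The characters of `T^d` as products of circle characters. [folklore] -/
theorem mFourier_apply_eq_prod (n : d → ℤ) (x : UnitAddTorus d) :
    mFourier n x = ∏ l, (fourier (n l) (x l) : ℂ) := by
  simp only [mFourier, ContinuousMap.coe_mk]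

/-- `e_{m eⱼ}(x) = e_m(x_j)`. [folklore] -/
theorem mFourier_single (j : d) (m : ℤ) (x : UnitAddTorus d) :
    mFourier (Pi.single j m) x = (fourier m (x j) : ℂ) := by
  rw [mFourier_apply_eq_prod]
  have h : ∀ l, (fourier ((Pi.single j m : d → ℤ) l) (x l) : ℂ) = if l = j then (fourier m (x j) : ℂ) else 1 := by
    intro l
    by_cases hl : l = j
    · subst hl; simp
    · simp [hl]
  simp_rw [h, Finset.prod_ite_eq' Finset.univ j, if_pos (Finset.mem_univ j)]

omit [Fintype d] [DecidableEq d] in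
/-- `e_n(-b) = e_{-n}(b)`. [folklore] -/
theorem fourier_apply_neg (n : ℤ) (b : UnitAddCircle) : fourier n (-b) = fourier (-n) b := by
  simp only [fourier_apply, smul_neg, neg_smul]

/-- **The phase function of a shear**: the `i`-th mode `n` picks up the factor
`g_n(b) = e_{-n}(φ(b)) = exp(-2πi n φ(b))` under `x ↦ x - φ(x_j) eᵢ`. [folklore] -/
def twist (P : ShearProfile) (n : ℤ) (b : UnitAddCircle) : ℂ :=
  fourier (-n) (((P.onCircle b : ℝ)) : UnitAddCircle)

omit [Fintype d] [DecidableEq d] in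
/-- Unfolding the phase function. [folklore] -/
theorem twist_apply (P : ShearProfile) (n : ℤ) (b : UnitAddCircle) :
    twist P n b = fourier (-n) (((P.onCircle b : ℝ)) : UnitAddCircle) := rfl

omit [Fintype d] [DecidableEq d] in
/-- The phase function at the class of `t`: `g_n(t) = exp(-2πi n φ(t))`. [folklore] -/
theorem twist_coe (P : ShearProfile) (n : ℤ) (t : ℝ) :
    twist P n (t : UnitAddCircle) = Complex.exp (-(2 * Real.pi * Complex.I * n * P t)) := by
  rw [twist_apply, ShearProfile.onCircle_coe, fourier_coe_apply]
  congr 1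
  push_cast
  ring

omit [Fintype d] [DecidableEq d] in
/-- The phase function is continuous. [folklore] -/
theorem continuous_twist (P : ShearProfile) (n : ℤ) : Continuous (twist P n) :=
  (fourier (-n)).continuous.comp ((AddCircle.continuous_mk' (1 : ℝ)).comp P.continuous_onCircle)

omit [Fintype d] [DecidableEq d] in
/-- The phase function is unimodular. [folklore] -/
@[simp]
theorem norm_twist (P : ShearProfile) (n : ℤ) (b : UnitAddCircle) : ‖twist P n b‖ = 1 := by
  rw [twist_apply]
  exact Circle.norm_coe _

omit [Fintype d] [DecidableEq d] in
/-- The zero mode is not twisted: `g_0 = 1`. [folklore] -/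
theorem twist_zero (P : ShearProfile) (b : UnitAddCircle) : twist P 0 b = 1 := by
  simp [twist_apply]

/-- **Characters composed with the shear**: `e_k(x - φ(x_j)eᵢ) = g_{k_i}(x_j) e_k(x)`. [folklore] -/
theorem mFourier_shearMap (k : d → ℤ) (i j : d) (P : ShearProfile) (x : UnitAddTorus d) :
    mFourier k (shearMap i j P x) = twist P (k i) (x j) * mFourier k x := by
  rw [shearMap_apply, sub_eq_add_neg, ← Pi.single_neg, mFourier_add_single, fourier_apply_neg,
    twist_apply]

/-! ## Fourier coefficients of a function of one coordinate -/

/-- A function of the coordinate `x_j` alone has no Fourier modes `κ` with `κ_l ≠ 0` for some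
`l ≠ j`. [folklore] -/
theorem mFourierCoeff_comp_eval_eq_zero (G : UnitAddCircle → V) (j : d) {κ : d → ℤ} {l : d}
    (hl : l ≠ j) (hκ : κ l ≠ 0) : mFourierCoeff (fun x : UnitAddTorus d => G (x j)) κ = 0 := by
  refine mFourierCoeff_eq_zero_of_forall_add_single (i := l) (fun s x => ?_) hκ
  simp [Pi.single_eq_of_ne hl.symm]

omit [Fintype d] [DecidableEq d] in
/-- The volume of `T = ℝ/ℤ` is its Haar probability measure. [folklore] -/
theorem volume_unitAddCircle_eq_haar : (volume : Measure UnitAddCircle) = AddCircle.haarAddCircle := by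
  rw [AddCircle.volume_eq_smul_haarAddCircle]; simp

/-- The `eⱼ`-modes of a function of `x_j` alone are its circle Fourier coefficients:
`𝓕(G ∘ eval_j)(m eⱼ) = Ĝ(m)` (the marginal of the volume of `T^d` along `eval_j` is the volume
of `T`). [folklore] -/
theorem mFourierCoeff_comp_eval_single {G : UnitAddCircle → V} (hG : Continuous G) (j : d) (m : ℤ) :
    mFourierCoeff (fun x : UnitAddTorus d => G (x j)) (Pi.single j m) = fourierCoeff G m := by
  rw [mFourierCoeff_eq_integral_volume, ← Pi.single_neg]
  simp_rw [mFourier_single]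
  set H : UnitAddCircle → V := fun b => (fourier (-m) b : ℂ) • G b with hH
  have hHc : Continuous H := ((fourier (-m)).continuous).smul hG
  haveI : IsProbabilityMeasure (volume : Measure UnitAddCircle) := by
    rw [volume_unitAddCircle_eq_haar]; infer_instance
  have hev : MeasurePreserving (fun x : UnitAddTorus d => x j) volume volume :=
    measurePreserving_eval (fun _ : d => (volume : Measure UnitAddCircle)) j
  change ∫ x : UnitAddTorus d, H (x j) = _
  rw [← integral_map (measurable_pi_apply j).aemeasurable (by rw [hev.map_eq]; exact hHc.aestronglyMeasurable),
    hev.map_eq, fourierCoeff.eq_1, volume_unitAddCircle_eq_haar]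

/-- Both cases at once: `𝓕(G ∘ eval_j)(κ) = Ĝ(κ_j)` if `κ` is supported on `{j}`, and `0`
otherwise. [folklore] -/
theorem mFourierCoeff_comp_eval {G : UnitAddCircle → V} (hG : Continuous G) (j : d) (κ : d → ℤ) :
    mFourierCoeff (fun x : UnitAddTorus d => G (x j)) κ =
      if ∀ l, l ≠ j → κ l = 0 then fourierCoeff G (κ j) else 0 := by
  split_ifs with h
  · have hκ : κ = Pi.single j (κ j) := by
      funext l
      by_cases hl : l = j
      · subst hl; simp
      · rw [Pi.single_eq_of_ne hl, h l hl]
    conv_lhs => rw [hκ]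
    exact mFourierCoeff_comp_eval_single hG j (κ j)
  · push Not at h
    obtain ⟨l, hl, hκ⟩ := h
    exact mFourierCoeff_comp_eval_eq_zero G j hl hκ

end Fourier


/-! ## The Koopman operator of a shear on the Fourier side: the fibre formula -/

section Fibre

/-- **Fibre formula.** For a continuous `θ : T^d → ℂ` with absolutely summable Fourier
coefficients (e.g. `θ` smooth) and the shear `Φ(x) = x - φ(x_j)eᵢ`, `i ≠ j`, the Fourier
coefficients of `θ ∘ Φ` are, mode by mode,
`𝓕(θ ∘ Φ)(k) = ∑_{m ∈ ℤ} ĝ_{k_i}(m) 𝓕θ(k - m eⱼ)`, `g_n = e_{-n} ∘ φ`: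
the shear acts on each fibre `{k : k_i = n}` of the frequency lattice separately, as the
convolution with the circle Fourier coefficients of the phase function `g_n` in the direction
`eⱼ` (expand `θ` in its absolutely convergent Fourier series, compose each character with the
shear, `mFourier_shearMap`, integrate term by term and use `mFourierCoeff_comp_eval`). [folklore] -/
theorem mFourierCoeff_comp_shearMap {θ : UnitAddTorus d → ℂ} (hθ : Continuous θ)
    (hsum : Summable fun k => ‖mFourierCoeff θ k‖) {i j : d} (hij : i ≠ j) (P : ShearProfile)
    (k : d → ℤ) :
    mFourierCoeff (θ ∘ shearMap i j P) k =
      ∑' m : ℤ, fourierCoeff (twist P (k i)) m * mFourierCoeff θ (k - Pi.single j m) := by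
  classical
  set f : C(UnitAddTorus d, ℂ) := ⟨θ, hθ⟩ with hf_def
  have hfθ : (f : UnitAddTorus d → ℂ) = θ := rfl
  have hs : Summable (mFourierCoeff (f : UnitAddTorus d → ℂ)) := .of_norm hsum
  -- the terms of the composed series and their integrals
  set S : (d → ℤ) → UnitAddTorus d → ℂ := fun k' x =>
    mFourier (-k) x * (mFourierCoeff θ k' * (twist P (k' i) (x j) * mFourier k' x)) with hS_def
  -- pointwise expansion of `e_{-k} · (θ ∘ Φ)`
  have hpt : ∀ x, HasSum (fun k' => S k' x) (mFourier (-k) x * θ (shearMap i j P x)) := by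
    intro x
    have h := (hasSum_mFourier_series_apply_of_summable hs (shearMap i j P x)).mul_left (mFourier (-k) x)
    refine h.congr_fun fun k' => ?_
    simp only [hS_def, hfθ, smul_eq_mul, mFourier_shearMap]
  -- summability of the sup norms
  have hSm : ∀ k', AEStronglyMeasurable (S k') volume := fun k' =>
    (((mFourier (-k)).continuous).mul (continuous_const.mul
      (((continuous_twist P (k' i)).comp (continuous_apply j)).mul (mFourier k').continuous))).aestronglyMeasurable
  have hSnorm : ∀ k' x, ‖S k' x‖ = ‖mFourierCoeff θ k'‖ := by
    intro k' x
    simp only [hS_def, norm_mul, norm_twist, norm_mFourier_apply, one_mul, mul_one]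
  have hSlint : ∀ k', ∫⁻ x, ‖S k' x‖ₑ ∂(volume : Measure (UnitAddTorus d)) = ‖mFourierCoeff θ k'‖ₑ := by
    intro k'
    have : (fun x => ‖S k' x‖ₑ) = fun _ => ‖mFourierCoeff θ k'‖ₑ := by
      funext x
      rw [← ofReal_norm, ← ofReal_norm, hSnorm]
    rw [this, lintegral_const, measure_univ, mul_one]
  have hStop : ∑' k', ∫⁻ x, ‖S k' x‖ₑ ∂(volume : Measure (UnitAddTorus d)) ≠ ⊤ := by
    simp_rw [hSlint]
    rw [show (fun k' => ‖mFourierCoeff θ k'‖ₑ) = fun k' => ((‖mFourierCoeff θ k'‖₊ : ℝ≥0) : ℝ≥0∞) from rfl]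
    exact ENNReal.tsum_coe_ne_top_iff_summable.2 (NNReal.summable_coe.1 (by simpa only [coe_nnnorm] using hsum))
  -- integrate term by term
  have hint : mFourierCoeff (θ ∘ shearMap i j P) k = ∑' k', ∫ x, S k' x := by
    rw [mFourierCoeff_eq_integral_volume]
    simp_rw [Function.comp_apply, smul_eq_mul]
    rw [← integral_tsum hSm hStop]
    exact integral_congr_ae (Eventually.of_forall fun x => ((hpt x).tsum_eq).symm)
  -- each term
  have hterm : ∀ k', ∫ x, S k' x =
      if ∀ l, l ≠ j → k' l = k l then fourierCoeff (twist P (k i)) (k j - k' j) * mFourierCoeff θ k' else 0 := by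
    intro k'
    have e1 : ∀ x, S k' x = mFourierCoeff θ k' * (mFourier (-(k - k')) x • twist P (k' i) (x j)) := by
      intro x
      simp only [hS_def, smul_eq_mul]
      have : mFourier (-(k - k')) x = mFourier (-k) x * mFourier k' x := by
        rw [show -(k - k') = -k + k' by abel, mFourier_add]
      rw [this]; ring
    simp_rw [e1]
    rw [integral_const_mul, ← mFourierCoeff_eq_integral_volume,
      mFourierCoeff_comp_eval (continuous_twist P (k' i)) j (k - k')]
    by_cases h : ∀ l, l ≠ j → k' l = k l
    · have h' : ∀ l, l ≠ j → (k - k') l = 0 := fun l hl => by simp [h l hl]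
      rw [if_pos h', if_pos h, h i hij, Pi.sub_apply, mul_comm]
    · have h' : ¬ ∀ l, l ≠ j → (k - k') l = 0 := by
        intro h''
        exact h fun l hl => by have := h'' l hl; rw [Pi.sub_apply, sub_eq_zero] at this; exact this.symm
      rw [if_neg h', if_neg h, mul_zero]
  rw [hint]
  simp_rw [hterm]
  -- reindex the fibre by `m ↦ k - m eⱼ`
  have hinj : Function.Injective fun m : ℤ => k - Pi.single j m := by
    intro m m' h
    have := congrFun h j
    simpa using this
  rw [← hinj.tsum_eq]
  · refine tsum_congr fun m => ?_
    have hm : ∀ l, l ≠ j → (k - Pi.single j m : d → ℤ) l = k l := fun l hl => by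
      simp [Pi.single_eq_of_ne hl]
    rw [if_pos hm]
    simp
  · intro k' hk'
    rw [Function.mem_support] at hk'
    by_cases h : ∀ l, l ≠ j → k' l = k l
    · refine ⟨k j - k' j, ?_⟩
      funext l
      by_cases hl : l = j
      · subst hl; simp
      · simp [Pi.single_eq_of_ne hl, h l hl]
    · exact absurd (if_neg h) hk'

end Fibre


/-! ## Consequences of the fibre formula -/

section Consequences

variable {θ : UnitAddTorus d → ℂ} {i j : d} {P : ShearProfile}

/-- **The shear preserves the support of the Fourier coefficients in the direction `eᵢ` of the
displacement**: if `𝓕θ` vanishes off `{k : k_i ∈ A}`, so does `𝓕(θ ∘ Φ)`. [folklore] -/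
theorem mFourierCoeff_comp_shearMap_eq_zero_of_apply_not_mem (hθ : Continuous θ)
    (hsum : Summable fun k => ‖mFourierCoeff θ k‖) (hij : i ≠ j) (P : ShearProfile) {A : Set ℤ}
    (hA : ∀ k : d → ℤ, k i ∉ A → mFourierCoeff θ k = 0) {k : d → ℤ} (hk : k i ∉ A) :
    mFourierCoeff (θ ∘ shearMap i j P) k = 0 := by
  rw [mFourierCoeff_comp_shearMap hθ hsum hij P k]
  refine (tsum_congr fun m => ?_).trans tsum_zero
  rw [hA _ (by simpa [Pi.single_eq_of_ne hij] using hk), mul_zero]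

omit [Fintype d] [DecidableEq d] in
/-- `e_m(1/F) = 1` iff `F ∣ m`. [folklore] -/
theorem fourier_inv_natCast_eq_one_iff {F : ℕ} (hF : 0 < F) (m : ℤ) :
    fourier m (((F : ℝ)⁻¹ : ℝ) : UnitAddCircle) = 1 ↔ (F : ℤ) ∣ m := by
  rw [fourier_coe_apply, Complex.exp_eq_one_iff]
  have hF' : (F : ℂ) ≠ 0 := by exact_mod_cast hF.ne'
  have h2πI : (2 * Real.pi * Complex.I : ℂ) ≠ 0 := by simp [Real.pi_ne_zero, Complex.I_ne_zero]
  have hrw : (2 * Real.pi * Complex.I * m * (((F : ℝ)⁻¹ : ℝ) : ℂ) / ((1 : ℝ) : ℂ) : ℂ) =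
      (m : ℂ) * (F : ℂ)⁻¹ * (2 * Real.pi * Complex.I) := by
    push_cast; ring
  constructor
  · rintro ⟨n, hn⟩
    refine ⟨n, ?_⟩
    have h : ((m : ℂ) * (F : ℂ)⁻¹ - n) * (2 * Real.pi * Complex.I) = 0 := by
      rw [hrw] at hn
      linear_combination hn
    rw [mul_eq_zero, sub_eq_zero] at h
    rcases h with h | h
    · have : (m : ℂ) = (F : ℂ) * n := by field_simp at h; linear_combination h
      exact_mod_cast this
    · exact absurd h h2πI
  · rintro ⟨n, rfl⟩
    refine ⟨n, ?_⟩
    rw [hrw]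
    push_cast
    field_simp

omit [Fintype d] [DecidableEq d] in
/-- **A `1/F`-periodic phase function has circle Fourier coefficients only at the multiples of
`F`.** [folklore] -/
theorem fourierCoeff_twist_eq_zero {F : ℕ} (hF : 0 < F) (hP : ∀ t, P (t + (F : ℝ)⁻¹) = P t)
    (n : ℤ) {m : ℤ} (hm : ¬ (F : ℤ) ∣ m) : fourierCoeff (twist P n) m = 0 := by
  set G : C(UnitAddCircle, ℂ) := ⟨twist P n, continuous_twist P n⟩ with hG_def
  have hper : ∀ b : UnitAddCircle, twist P n (b + (((F : ℝ)⁻¹ : ℝ) : UnitAddCircle)) = twist P n b := by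
    intro b
    induction b using QuotientAddGroup.induction_on with
    | H t => rw [← AddCircle.coe_add, twist_coe, twist_coe, hP]
  have h := Literature.Analysis.Fourier.fourierCoeff_comp_add_right G (((F : ℝ)⁻¹ : ℝ) : UnitAddCircle) m
  have hfun : (fun x => G (x + (((F : ℝ)⁻¹ : ℝ) : UnitAddCircle))) = twist P n := funext hper
  rw [hfun, show (G : UnitAddCircle → ℂ) = twist P n from rfl] at h
  have hne : fourier m (((F : ℝ)⁻¹ : ℝ) : UnitAddCircle) ≠ 1 := fun h1 =>
    hm ((fourier_inv_natCast_eq_one_iff hF m).1 h1)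
  have h' : (1 - fourier m (((F : ℝ)⁻¹ : ℝ) : UnitAddCircle)) * fourierCoeff (twist P n) m = 0 := by
    rw [sub_mul, one_mul, ← h, sub_self]
  exact (mul_eq_zero.1 h').resolve_left (sub_ne_zero.2 (Ne.symm hne))

/-- A set of integers invariant under the shift by `F` is invariant under all shifts by
multiples of `F`. [folklore] -/
theorem mem_iff_add_mul_mem_of_forall {N : Set ℤ} {F : ℤ} (hN : ∀ n, n ∈ N ↔ n + F ∈ N) (n c : ℤ) :
    n ∈ N ↔ n + c * F ∈ N := by
  induction c using Int.induction_on with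
  | zero => simp
  | succ c ih => rw [ih, hN, add_mul, one_mul, add_assoc]
  | pred c ih =>
    rw [ih, hN (n + (-(c : ℤ) - 1) * F)]
    congr! 1
    ring

/-- **The shear preserves `F`-invariant supports in the driving direction `eⱼ`**: if the profile
is `1/F`-periodic and `𝓕θ` vanishes off `{k : k_j ∈ N}` for a set `N` invariant under the shift
by `F`, then so does `𝓕(θ ∘ Φ)` (the shear only moves `k_j` by multiples of `F`). [folklore] -/
theorem mFourierCoeff_comp_shearMap_eq_zero_of_invariant (hθ : Continuous θ)
    (hsum : Summable fun k => ‖mFourierCoeff θ k‖) (hij : i ≠ j) {F : ℕ} (hF : 0 < F)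
    (hP : ∀ t, P (t + (F : ℝ)⁻¹) = P t) {N : Set ℤ} (hN : ∀ n, n ∈ N ↔ n + F ∈ N)
    (hθN : ∀ k : d → ℤ, k j ∉ N → mFourierCoeff θ k = 0) {k : d → ℤ} (hk : k j ∉ N) :
    mFourierCoeff (θ ∘ shearMap i j P) k = 0 := by
  rw [mFourierCoeff_comp_shearMap hθ hsum hij P k]
  refine (tsum_congr fun m => ?_).trans tsum_zero
  by_cases hm : (F : ℤ) ∣ m
  · obtain ⟨c, rfl⟩ := hm
    rw [hθN _ ?_, mul_zero]
    intro hmem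
    apply hk
    rw [mem_iff_add_mul_mem_of_forall hN (k j) (-c)]
    simpa [sub_eq_add_neg, mul_comm] using hmem
  · rw [fourierCoeff_twist_eq_zero hF hP _ hm, zero_mul]

omit [Fintype d] [DecidableEq d] in
/-- **The mean of the phase function** is the oscillatory integral of the profile over a period:
`ĝ_n(0) = ∫₀¹ exp(-2πi n φ(t)) dt`. [folklore] -/
theorem fourierCoeff_twist_zero (P : ShearProfile) (n : ℤ) :
    fourierCoeff (twist P n) 0 = ∫ t in (0 : ℝ)..1, Complex.exp (-(2 * Real.pi * Complex.I * n * P t)) := by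
  rw [fourierCoeff_eq_intervalIntegral (twist P n) 0 0, zero_add, div_one, one_smul]
  refine intervalIntegral.integral_congr fun t _ => ?_
  simp only [neg_zero, fourier_zero, one_smul, twist_coe]

omit [Fintype d] [DecidableEq d] in
/-- The mean of the phase function of a scaled profile only sees the base profile:
`ĝ_n(0) = ∫₀¹ exp(-2πi n D S(t)) dt`. [folklore] -/
theorem fourierCoeff_twist_scale_zero (S : ShearProfile) (D : ℝ) {F : ℕ} (hF : 0 < F) (n : ℤ) :
    fourierCoeff (twist (S.scale D F) n) 0 =
      ∫ t in (0 : ℝ)..1, Complex.exp (-(2 * Real.pi * Complex.I * n * (D * S t))) := by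
  rw [fourierCoeff_twist_zero]
  simp only [ShearProfile.scale_apply]
  push_cast
  exact intervalIntegral_comp_natCast_mul (g := fun t => Complex.exp (-(2 * Real.pi * Complex.I * n * (D * S t))))
    (Complex.continuous_exp.comp ((continuous_const.mul (continuous_const.mul
      (Complex.continuous_ofReal.comp S.continuous))).neg)) (fun t => by simp only [S.periodic t]) hF

/-- **On functions band limited in the driving direction the shear is a Fourier multiplier near
the origin.** If the profile is `1/F`-periodic and `𝓕θ` is supported in `{k : 2|k_j| < F}`, then
for every `k` with `2|k_j| < F`, `𝓕(θ ∘ Φ)(k) = ĝ_{k_i}(0) 𝓕θ(k)` — the only term of the fibre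
formula that survives is `m = 0` (the others are either killed by `ĝ_{k_i}(m) = 0`, `F ∤ m`, or
read `𝓕θ` at `|k_j - m| ≥ F/2`). [folklore] -/
theorem mFourierCoeff_comp_shearMap_of_band (hθ : Continuous θ)
    (hsum : Summable fun k => ‖mFourierCoeff θ k‖) (hij : i ≠ j) {F : ℕ} (hF : 0 < F)
    (hP : ∀ t, P (t + (F : ℝ)⁻¹) = P t)
    (hband : ∀ k : d → ℤ, (F : ℤ) ≤ 2 * |k j| → mFourierCoeff θ k = 0) {k : d → ℤ}
    (hk : 2 * |k j| < F) :
    mFourierCoeff (θ ∘ shearMap i j P) k = fourierCoeff (twist P (k i)) 0 * mFourierCoeff θ k := by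
  rw [mFourierCoeff_comp_shearMap hθ hsum hij P k, tsum_eq_single 0]
  · simp
  · intro m hm0
    by_cases hm : (F : ℤ) ∣ m
    · rw [hband _ ?_, mul_zero]
      obtain ⟨c, rfl⟩ := hm
      have hc : c ≠ 0 := by rintro rfl; simp at hm0
      have h1 : (1 : ℤ) ≤ |c| := Int.one_le_abs hc
      have hkj : (k - Pi.single j ((F : ℤ) * c) : d → ℤ) j = k j - F * c := by simp
      rw [hkj]
      have hF0 : (0 : ℤ) ≤ F := by positivity
      have : |(F : ℤ) * c| = F * |c| := by rw [abs_mul, abs_of_nonneg hF0]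
      have htri : |(F : ℤ) * c| - |k j| ≤ |k j - F * c| := by
        have := abs_sub_abs_le_abs_sub ((F : ℤ) * c) (k j)
        rwa [abs_sub_comm] at this
      nlinarith
    · rw [fourierCoeff_twist_eq_zero hF hP _ hm, zero_mul]

end Consequences


/-! ## Spectral pieces of a smooth function -/

section Pieces

variable {V : Type*} [NormedAddCommGroup V] [NormedSpace ℂ V] [CompleteSpace V]

/-- **The spectral piece of `θ` on a set of modes `A`**: the synthesis of the Fourier
coefficients of `θ` restricted to `A` (for smooth `θ` a smooth function with
`𝓕(θ_A) = 1_A · 𝓕θ`). [folklore] -/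
def modePiece (A : Set (d → ℤ)) (θ : UnitAddTorus d → V) : UnitAddTorus d → V :=
  fourierSynth (A.indicator (mFourierCoeff θ))

variable {θ : UnitAddTorus d → V}

omit [Fintype d] [DecidableEq d] [NormedSpace ℂ V] [CompleteSpace V] in
/-- The indicator of a finite pairwise disjoint union is the sum of the indicators. [folklore] -/
theorem indicator_biUnion_finset_apply {α ι : Type*} (s : Finset ι) (A : ι → Set α) (f : α → V)
    (hdisj : (s : Set ι).PairwiseDisjoint A) (a : α) :
    (⋃ n ∈ s, A n).indicator f a = ∑ n ∈ s, (A n).indicator f a := by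
  classical
  by_cases ha : ∃ n ∈ s, a ∈ A n
  · obtain ⟨n, hn, han⟩ := ha
    have hmem : a ∈ ⋃ n ∈ s, A n := Set.mem_iUnion₂.2 ⟨n, hn, han⟩
    rw [Set.indicator_of_mem hmem, Finset.sum_eq_single n, Set.indicator_of_mem han]
    · intro m hm hmn
      refine Set.indicator_of_notMem (fun ham => ?_) _
      exact Set.disjoint_left.1 (hdisj hm hn hmn) ham han
    · exact fun h => absurd hn h
  · rw [Set.indicator_of_notMem, Finset.sum_eq_zero]
    · intro n hn
      exact Set.indicator_of_notMem (fun han => ha ⟨n, hn, han⟩) _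
    · intro h
      rw [Set.mem_iUnion₂] at h
      obtain ⟨n, hn, han⟩ := h
      exact ha ⟨n, hn, han⟩

omit [DecidableEq d] [CompleteSpace V] in
/-- Unfolding the spectral piece as a Fourier series. [folklore] -/
theorem modePiece_apply (A : Set (d → ℤ)) (θ : UnitAddTorus d → V) (x : UnitAddTorus d) :
    modePiece A θ x = ∑' k, mFourier k x • A.indicator (mFourierCoeff θ) k := rfl

/-- Restricted coefficients of a smooth function decay rapidly. [folklore] -/
theorem rapidDecay_indicator_mFourierCoeff (hθ : IsSmooth θ) (A : Set (d → ℤ)) :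
    RapidDecay (A.indicator (mFourierCoeff θ)) :=
  hθ.rapidDecay_mFourierCoeff.of_norm_le_mul (C := 1) fun k => by
    rw [one_mul]; exact norm_indicator_le_norm_self _ _

/-- Spectral pieces of smooth functions are smooth. [folklore] -/
theorem isSmooth_modePiece (hθ : IsSmooth θ) (A : Set (d → ℤ)) : IsSmooth (modePiece A θ) :=
  (rapidDecay_indicator_mFourierCoeff hθ A).isSmooth_fourierSynth

/-- `𝓕(θ_A)(k) = 1_A(k) 𝓕θ(k)`. [folklore] -/
theorem mFourierCoeff_modePiece (hθ : IsSmooth θ) (A : Set (d → ℤ)) (k : d → ℤ) :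
    mFourierCoeff (modePiece A θ) k = A.indicator (mFourierCoeff θ) k :=
  (rapidDecay_indicator_mFourierCoeff hθ A).mFourierCoeff_fourierSynth k

/-- `θ = θ_A + θ_{Aᶜ}`. [folklore] -/
theorem modePiece_add_modePiece_compl (hθ : IsSmooth θ) (A : Set (d → ℤ)) :
    modePiece A θ + modePiece Aᶜ θ = θ := by
  refine IsSmooth.ext_mFourierCoeff ((isSmooth_modePiece hθ A).add (isSmooth_modePiece hθ Aᶜ)) hθ
    fun k => ?_
  have hadd : mFourierCoeff (modePiece A θ + modePiece Aᶜ θ) k =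
      mFourierCoeff (modePiece A θ) k + mFourierCoeff (modePiece Aᶜ θ) k := by
    have h := mFourierCoeff_sub ((isSmooth_modePiece hθ A).add (isSmooth_modePiece hθ Aᶜ)).integrable
      (isSmooth_modePiece hθ Aᶜ).integrable k
    rw [add_sub_cancel_right] at h
    rw [eq_sub_iff_add_eq] at h
    exact h.symm
  rw [hadd, mFourierCoeff_modePiece hθ, mFourierCoeff_modePiece hθ, Set.indicator_self_add_compl_apply]

/-- A smooth function supported (in frequency) on `A` is its own `A`-piece. [folklore] -/
theorem modePiece_eq_self (hθ : IsSmooth θ) {A : Set (d → ℤ)}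
    (hA : ∀ k ∉ A, mFourierCoeff θ k = 0) : modePiece A θ = θ := by
  refine IsSmooth.ext_mFourierCoeff (isSmooth_modePiece hθ A) hθ fun k => ?_
  rw [mFourierCoeff_modePiece hθ]
  by_cases hk : k ∈ A
  · rw [Set.indicator_of_mem hk]
  · rw [Set.indicator_of_notMem hk, hA k hk]

/-- Finite sums of spectral pieces on pairwise disjoint sets: `∑_{n ∈ s} θ_{A n} = θ_{⋃ A n}`.
[folklore] -/
theorem sum_modePiece_eq (hθ : IsSmooth θ) {ι : Type*} (s : Finset ι) (A : ι → Set (d → ℤ))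
    (hdisj : (s : Set ι).PairwiseDisjoint A) :
    ∑ n ∈ s, modePiece (A n) θ = modePiece (⋃ n ∈ s, A n) θ := by
  funext x
  rw [Finset.sum_apply]
  simp only [modePiece_apply]
  rw [← Summable.tsum_finsetSum (fun n _ => ((rapidDecay_indicator_mFourierCoeff hθ (A n)).hasSum_fourierSynth x).summable)]
  refine tsum_congr fun k => ?_
  rw [← Finset.smul_sum, indicator_biUnion_finset_apply s A _ hdisj]

/-- **Decomposition into finitely many disjoint spectral pieces**: if `𝓕θ` is supported on the
union of pairwise disjoint sets `A n`, `n ∈ s`, then `θ = ∑_{n ∈ s} θ_{A n}`. [folklore] -/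
theorem eq_sum_modePiece (hθ : IsSmooth θ) {ι : Type*} (s : Finset ι) (A : ι → Set (d → ℤ))
    (hdisj : (s : Set ι).PairwiseDisjoint A)
    (hsupp : ∀ k, mFourierCoeff θ k ≠ 0 → ∃ n ∈ s, k ∈ A n) :
    θ = ∑ n ∈ s, modePiece (A n) θ := by
  rw [sum_modePiece_eq hθ s A hdisj, modePiece_eq_self hθ]
  intro k hk
  by_contra h
  obtain ⟨n, hn, hkn⟩ := hsupp k h
  exact hk (Set.mem_biUnion hn hkn)

end Pieces


/-! ## Monochromatic functions and the near-identity estimate -/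

section NearIdentity

/-- The fibre of the frequency lattice over the `i`-th frequency `n`. [folklore] -/
def fibre (i : d) (n : ℤ) : Set (d → ℤ) := {k | k i = n}

omit [Fintype d] [DecidableEq d] in
/-- Membership in a fibre. [folklore] -/
@[simp]
theorem mem_fibre {i : d} {n : ℤ} {k : d → ℤ} : k ∈ fibre i n ↔ k i = n := Iff.rfl

omit [Fintype d] [DecidableEq d] in
/-- Distinct fibres are disjoint. [folklore] -/
theorem pairwiseDisjoint_fibre (i : d) (s : Set ℤ) : s.PairwiseDisjoint (fibre i) := by
  intro n _ m _ hnm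
  refine Set.disjoint_left.2 fun k hkn hkm => hnm ?_
  rw [mem_fibre] at hkn hkm
  rw [← hkn, ← hkm]

variable {θ : UnitAddTorus d → ℂ} {i j : d}

/-- **Monochromatic functions are eigen-sheets of the shear**: if all Fourier modes of a smooth
`θ` have the same `i`-th frequency `n`, then `θ(x - φ(x_j)eᵢ) = g_n(x_j) θ(x)` pointwise. [folklore] -/
theorem comp_shearMap_of_fibre (hθ : IsSmooth θ) {n : ℤ} (hn : ∀ k, mFourierCoeff θ k ≠ 0 → k i = n)
    (P : ShearProfile) (j : d) (x : UnitAddTorus d) :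
    θ (shearMap i j P x) = twist P n (x j) * θ x := by
  set f : C(UnitAddTorus d, ℂ) := ⟨θ, hθ.continuous⟩
  have hs : Summable (mFourierCoeff (f : UnitAddTorus d → ℂ)) := hθ.rapidDecay_mFourierCoeff.summable
  have h1 := hasSum_mFourier_series_apply_of_summable hs (shearMap i j P x)
  have h2 := (hasSum_mFourier_series_apply_of_summable hs x).mul_left (twist P n (x j))
  have heq : (fun k => mFourierCoeff (f : UnitAddTorus d → ℂ) k • mFourier k (shearMap i j P x)) =
      fun k => twist P n (x j) * (mFourierCoeff (f : UnitAddTorus d → ℂ) k • mFourier k x) := by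
    funext k
    change mFourierCoeff θ k • mFourier k (shearMap i j P x) = twist P n (x j) * (mFourierCoeff θ k • mFourier k x)
    by_cases hk : mFourierCoeff θ k = 0
    · simp [hk]
    · rw [mFourier_shearMap, hn k hk, smul_eq_mul, smul_eq_mul]; ring
  rw [heq] at h1
  exact h1.unique h2


omit [DecidableEq d] in
/-- Continuous functions on `T^d` have integrable squared norm. [folklore] -/
theorem integrable_norm_sq_of_continuous {V : Type*} [NormedAddCommGroup V] {f : UnitAddTorus d → V}
    (hf : Continuous f) : Integrable (fun x => ‖f x‖ ^ 2) volume :=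
  ((continuous_norm.comp hf).pow 2).integrable_of_hasCompactSupport (HasCompactSupport.of_compactSpace _)

omit [DecidableEq d] in
/-- **Parseval across fibres.** Smooth functions whose Fourier coefficients live on distinct
fibres `{k : k_i = n}` are `L²`-orthogonal: `∫ ‖∑_{n ∈ s} f_n‖² = ∑_{n ∈ s} ∫ ‖f_n‖²`. [folklore] -/
theorem integral_norm_sq_sum_eq_of_fibre (i : d) (s : Finset ℤ) {f : ℤ → UnitAddTorus d → ℂ}
    (hf : ∀ n ∈ s, IsSmooth (f n)) (hsupp : ∀ n ∈ s, ∀ k, mFourierCoeff (f n) k ≠ 0 → k i = n) :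
    ∫ x, ‖∑ n ∈ s, f n x‖ ^ 2 = ∑ n ∈ s, ∫ x, ‖f n x‖ ^ 2 := by
  have hFc : Continuous fun x => ∑ n ∈ s, f n x := continuous_finsetSum s fun n hn => (hf n hn).continuous
  have hP := hasSum_sq_mFourierCoeff_of_continuous hFc
  have hcoeff : ∀ k, mFourierCoeff (fun x => ∑ n ∈ s, f n x) k = ∑ n ∈ s, mFourierCoeff (f n) k :=
    mFourierCoeff_finset_sum s fun n hn => (hf n hn).integrable
  -- at most one fibre contributes to each mode
  have hpt : ∀ k, ‖mFourierCoeff (fun x => ∑ n ∈ s, f n x) k‖ ^ 2 = ∑ n ∈ s, ‖mFourierCoeff (f n) k‖ ^ 2 := by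
    intro k
    rw [hcoeff]
    by_cases hk : k i ∈ s
    · rw [Finset.sum_eq_single (k i), Finset.sum_eq_single (k i)]
      · intro n hn hne
        rw [show mFourierCoeff (f n) k = 0 from not_not.1 fun h => hne (hsupp n hn k h).symm]
        simp
      · exact fun h => absurd hk h
      · intro n hn hne
        exact not_not.1 fun h => hne (hsupp n hn k h).symm
      · exact fun h => absurd hk h
    · have h0 : ∀ n ∈ s, mFourierCoeff (f n) k = 0 := fun n hn =>
        not_not.1 fun h => hk ((hsupp n hn k h) ▸ hn)
      rw [Finset.sum_eq_zero h0, Finset.sum_eq_zero (fun n hn => by rw [h0 n hn]; simp)]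
      simp
  have hQ : HasSum (fun k => ∑ n ∈ s, ‖mFourierCoeff (f n) k‖ ^ 2) (∑ n ∈ s, ∫ x, ‖f n x‖ ^ 2) :=
    hasSum_sum fun n hn => hasSum_sq_mFourierCoeff_of_continuous (hf n hn).continuous
  simp_rw [← hpt] at hQ
  exact hP.unique hQ

omit [Fintype d] [DecidableEq d] in
/-- `|g_n(b) - 1| ≤ 2π |n| sup|φ|`. [folklore] -/
theorem norm_twist_sub_one_le (P : ShearProfile) {M : ℝ} (hM : ∀ t, |P t| ≤ M) (n : ℤ) (b : UnitAddCircle) :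
    ‖twist P n b - 1‖ ≤ 2 * Real.pi * |(n : ℝ)| * M := by
  induction b using QuotientAddGroup.induction_on with
  | H t =>
    rw [twist_coe]
    have h : (-(2 * Real.pi * Complex.I * n * P t) : ℂ) = Complex.I * ((-(2 * Real.pi * n * P t) : ℝ) : ℂ) := by
      push_cast; ring
    rw [h]
    refine (Real.norm_exp_I_mul_ofReal_sub_one_le).trans ?_
    rw [Real.norm_eq_abs, abs_neg, abs_mul, abs_mul, abs_of_pos Real.two_pi_pos]
    have hM0 : 0 ≤ M := (abs_nonneg _).trans (hM 0)
    gcongr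
    exact hM t

/-- **Near-identity estimate.** For a smooth `θ` whose Fourier modes have `|k_i| ≤ κ` and a
shear along `eᵢ` with displacement profile bounded by `M`,
`∫ ‖θ ∘ Φ - θ‖² ≤ (2πκM)² ∫ ‖θ‖²`: on the fibre `k_i = n` the shear multiplies by the phase
`g_n(x_j)` with `|g_n - 1| ≤ 2π|n|M`, and distinct fibres are orthogonal. [folklore] -/
theorem integral_norm_sq_comp_shearMap_sub_le (hθ : IsSmooth θ) (hij : i ≠ j) (P : ShearProfile)
    {κ : ℕ} (hband : ∀ k, mFourierCoeff θ k ≠ 0 → |k i| ≤ κ) {M : ℝ} (hM : ∀ t, |P t| ≤ M) :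
    ∫ x, ‖θ (shearMap i j P x) - θ x‖ ^ 2 ≤ (2 * Real.pi * κ * M) ^ 2 * ∫ x, ‖θ x‖ ^ 2 := by
  classical
  set s : Finset ℤ := Finset.Icc (-(κ : ℤ)) κ with hs_def
  set θn : ℤ → UnitAddTorus d → ℂ := fun n => modePiece (fibre i n) θ with hθn_def
  have hθn_smooth : ∀ n, IsSmooth (θn n) := fun n => isSmooth_modePiece hθ _
  have hθn_coeff : ∀ n k, mFourierCoeff (θn n) k = (fibre i n).indicator (mFourierCoeff θ) k :=
    fun n k => mFourierCoeff_modePiece hθ _ k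
  have hθn_supp : ∀ n k, mFourierCoeff (θn n) k ≠ 0 → k i = n := by
    intro n k hk
    rw [hθn_coeff] at hk
    by_contra h
    exact hk (Set.indicator_of_notMem (by simpa using h) _)
  -- `θ = ∑ θ_n`
  have hdec : θ = ∑ n ∈ s, θn n := by
    refine eq_sum_modePiece hθ s (fibre i) ((pairwiseDisjoint_fibre i _)) fun k hk => ⟨k i, ?_, rfl⟩
    have := hband k hk
    rw [hs_def, Finset.mem_Icc]
    exact abs_le.1 this
  -- the differences `g_n = θ_n ∘ Φ - θ_n`
  set g : ℤ → UnitAddTorus d → ℂ := fun n x => θn n (shearMap i j P x) - θn n x with hg_def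
  have hg_smooth : ∀ n, IsSmooth (g n) := fun n => ((hθn_smooth n).comp_shearMap i j P).sub (hθn_smooth n)
  have hg_supp : ∀ n k, mFourierCoeff (g n) k ≠ 0 → k i = n := by
    intro n k hk
    by_contra h
    apply hk
    change mFourierCoeff ((θn n ∘ shearMap i j P) - θn n) k = 0
    rw [mFourierCoeff_sub ((hθn_smooth n).comp_shearMap i j P).integrable (hθn_smooth n).integrable,
      mFourierCoeff_comp_shearMap_eq_zero_of_apply_not_mem (A := {n}) (hθn_smooth n).continuous
        (hθn_smooth n).rapidDecay_mFourierCoeff.summable_norm hij P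
        (fun k' hk' => not_not.1 fun h' => hk' (hθn_supp n k' h')) (by simpa using h),
      not_not.1 fun h' => h (hθn_supp n k h'), sub_zero]
  have hdiff : ∀ x, θ (shearMap i j P x) - θ x = ∑ n ∈ s, g n x := by
    intro x
    have h1 := congrFun hdec (shearMap i j P x)
    have h2 := congrFun hdec x
    rw [Finset.sum_apply] at h1 h2
    rw [h1, h2, ← Finset.sum_sub_distrib]
  -- the pointwise bound on each fibre
  have hgn : ∀ n ∈ s, ∀ x, ‖g n x‖ ^ 2 ≤ (2 * Real.pi * κ * M) ^ 2 * ‖θn n x‖ ^ 2 := by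
    intro n hn x
    have hmono := comp_shearMap_of_fibre (hθn_smooth n) (hθn_supp n) P j x
    have hgx : g n x = (twist P n (x j) - 1) * θn n x := by
      simp only [hg_def, hmono]; ring
    rw [hgx, norm_mul, mul_pow]
    refine mul_le_mul_of_nonneg_right ?_ (sq_nonneg _)
    have hnκ : |(n : ℝ)| ≤ κ := by
      rw [hs_def, Finset.mem_Icc] at hn
      have : |n| ≤ (κ : ℤ) := abs_le.2 hn
      exact_mod_cast this
    have hM0 : 0 ≤ M := (abs_nonneg _).trans (hM 0)
    have h := norm_twist_sub_one_le P hM n (x j)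
    have h' : 2 * Real.pi * |(n : ℝ)| * M ≤ 2 * Real.pi * κ * M := by
      gcongr
    exact pow_le_pow_left₀ (norm_nonneg _) (h.trans h') 2
  -- assemble
  calc ∫ x, ‖θ (shearMap i j P x) - θ x‖ ^ 2 = ∫ x, ‖∑ n ∈ s, g n x‖ ^ 2 := by simp_rw [hdiff]
    _ = ∑ n ∈ s, ∫ x, ‖g n x‖ ^ 2 :=
        integral_norm_sq_sum_eq_of_fibre i s (fun n _ => hg_smooth n) (fun n _ => hg_supp n)
    _ ≤ ∑ n ∈ s, ∫ x, (2 * Real.pi * κ * M) ^ 2 * ‖θn n x‖ ^ 2 :=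
        Finset.sum_le_sum fun n hn => integral_mono (integrable_norm_sq_of_continuous (hg_smooth n).continuous)
          ((integrable_norm_sq_of_continuous (hθn_smooth n).continuous).const_mul _) (hgn n hn)
    _ = (2 * Real.pi * κ * M) ^ 2 * ∑ n ∈ s, ∫ x, ‖θn n x‖ ^ 2 := by
        rw [Finset.mul_sum]
        refine Finset.sum_congr rfl fun n _ => integral_const_mul _ _
    _ = (2 * Real.pi * κ * M) ^ 2 * ∫ x, ‖θ x‖ ^ 2 := by
        congr 1
        rw [← integral_norm_sq_sum_eq_of_fibre i s (fun n _ => hθn_smooth n) (fun n _ => hθn_supp n)]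
        refine integral_congr_ae (Eventually.of_forall fun x => ?_)
        have h2 := congrFun hdec x
        rw [Finset.sum_apply] at h2
        simp only [h2]

end NearIdentity

end Literature.Analysis.FunctionSpaces.Torus
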